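import Literature.NumberTheory.NumberFields.TableAlgebra
import Mathlib.Algebra.Algebra.Basic
import HarnessLib

/-!
# Commutative rings from multiplication tables: the universal property over a base ring

Topic `NumberTheory/NumberFields`. A small complement to `TableAlgebra.lean`: for a table `S`, a
commutative ring `R` and a commutative `R`-algebra `A`, a system `e : Fin n → A` for `S`
(`TableSpec.IsSystem`: `eₐ e_b = Σ T a b c · e_c`, `Σ one a · eₐ = 1`) induces the ring homomorphism
`TAlg S R →+* A`, `u ↦ Σₐ uₐ · eₐ` (`TableSpec.liftA`; the tree's `TableSpec.lift` is the case
`R = ℤ`). Used to realise NESTED table algebras `TAlg S₁ (TAlg S₂ ℤ)` (tensor products computed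
factor by factor) inside a field. [folklore]

## References

* H. Cohen, *A Course in Computational Algebraic Number Theory*, GTM 138 (1993), §4.2
  (orders given by multiplication tables). [folklore]
-/

namespace Literature.NumberTheory.NumberFields

namespace TableSpec

open Finset

variable {n : ℕ} {S : TableSpec n} {R : Type*} [CommRing R] {A : Type*} [CommRing A] [Algebra R A]

/-- The additive realisation `u ↦ Σ uₐ eₐ` over the base ring `R`. [folklore] -/
def liftAFun (e : Fin n → A) (u : TAlg S R) : A := ∑ a, algebraMap R A (u.coef a) * e a

/-- **The universal property of the table algebra over a base ring**: a system `e` in an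
`R`-algebra `A` induces the ring homomorphism `TAlg S R →+* A`, `u ↦ Σ uₐ eₐ`. [folklore] -/
def liftA [Fact S.IsRing] {e : Fin n → A} (he : S.IsSystem e) : TAlg S R →+* A where
  toFun := liftAFun e
  map_one' := by
    simp only [liftAFun, TAlg.one_coef, map_intCast]
    exact he.one_eq
  map_mul' u v := by
    simp only [liftAFun, TAlg.mul_coef, map_sum, map_mul, map_intCast]
    rw [Finset.sum_mul_sum]
    simp_rw [show ∀ a b, algebraMap R A (u.coef a) * e a * (algebraMap R A (v.coef b) * e b) =
      algebraMap R A (u.coef a) * algebraMap R A (v.coef b) * (e a * e b) from fun a b => by ring, he.mul_eq,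
      Finset.mul_sum, Finset.sum_mul]
    rw [Finset.sum_comm]
    refine Finset.sum_congr rfl fun a _ => ?_
    rw [Finset.sum_comm]
    exact Finset.sum_congr rfl fun b _ => Finset.sum_congr rfl fun d _ => by ring
  map_zero' := by simp [liftAFun]
  map_add' u v := by
    simp only [liftAFun, TAlg.add_coef, map_add, add_mul, Finset.sum_add_distrib]

/-- `liftA` is `Σ uₐ eₐ`. [folklore] -/
theorem liftA_apply [Fact S.IsRing] {e : Fin n → A} (he : S.IsSystem e) (u : TAlg S R) :
    liftA he u = ∑ a, algebraMap R A (u.coef a) * e a := rfl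

/-- **`liftA eₐ = eₐ`.** [folklore] -/
theorem liftA_basis [Fact S.IsRing] {e : Fin n → A} (he : S.IsSystem e) (a : Fin n) :
    liftA he (TAlg.basis a : TAlg S R) = e a := by
  rw [liftA_apply]
  simp only [TAlg.basis_coef, apply_ite (algebraMap R A), map_one, map_zero, ite_mul, one_mul, zero_mul,
    Finset.sum_ite_eq', Finset.mem_univ, if_true]

/-- `liftA` on a coefficient-wise image: `liftA (map f u) = Σ f(uₐ) eₐ`. [folklore] -/
theorem liftA_map [Fact S.IsRing] {R₀ : Type*} [CommRing R₀] (f : R₀ →+* R) {e : Fin n → A} (he : S.IsSystem e)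
    (u : TAlg S R₀) : liftA he (TAlg.map f u) = ∑ a, algebraMap R A (f (u.coef a)) * e a := by
  rw [liftA_apply]; rfl

end TableSpec

end Literature.NumberTheory.NumberFields
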